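import Mathlib
import Summits.NavierStokesRegularity.NavierStokesRegularity.Theorems.EulerZoomLiouvillePowerGaugeEulerLiouvilleNeedleSupportDensityFloor
import Summits.NavierStokesRegularity.NavierStokesRegularity.Theorems.EulerZoomLiouvillePowerGaugeEulerLiouvilleMomentFloorGlue
import Summits.NavierStokesRegularity.NavierStokesRegularity.Theorems.EulerZoomLiouvillePowerGaugeEulerLiouvilleNeedleThinCoreMember
import HarnessLib

/-!
# Crux `EulerZoomLiouville.PowerGaugeEulerLiouville` (stmt-NavierStokesRegularity-19832): THE R53 FACES AS MEMBERS, MODULO THE FLOOR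
# — «L^q vorticity» and «sub-borderline vorticity in q-mean» (ROUND-53 «THE FLOOR», nsreg-p2 g43)

Route №10 `EulerZoomLiouville` (NavierStokesRegularity), crux E = stmt-NavierStokesRegularity-19832; LEAD ns-typeII-p2 g15.
ROUND-53 keys two faces for the LEAD's disjunction `IsKinematicTameProfile` (defs of record: ns-ezl-w2 g6's `…MomentFloorGlue`, p705397):
`MomentFloor.HasLqVorticity ρ V` (`∫‖curl V‖^q < ∞` for ONE `q ∈ (0, 3/(2+ρ))`, NO tameness) and `MomentFloor.HasSubBorderlineVorticity ρ V`
(for some `q ∈ (0,1)` the `q`-mean of the vorticity on `B_R` dips below every multiple of the borderline `R^{3−q(2+ρ)}` along `R → ∞`).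
THE FLOOR `MomentFloor.MomentFloorLaw ρ V` (t57-F3, ns-ezl-w3 g8, assembling sfl-p1's F1 `TwoSidedMomentLaw` and the LEAD's F3a
`Floor.supportDensityFloor`) denies both for non-trivial profiles (glue `MomentFloor.curl_eq_zero_of_hasLqVorticity_of_momentFloorLaw`,
`MomentFloor.curl_eq_zero_of_subBorderline_of_momentFloorLaw`).  This file turns the two faces into MEMBERS of the crux class CONDITIONAL on
the floor, so that the faces wire into the skeleton the moment t57-F3 lands (one application discharges `hfloor`):

* `Floor.inputs_of_selfSimilarC2` — the three R53 inputs of a `C²` exactly self-similar class member (`0 < ρ < 1`): a classical pressure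
  `P'` with `IsSelfSimilarEulerProfile (1/(2+ρ)) 0 V P'` (`WeakToClassical.exists_isSelfSimilarEulerProfile_of_contDiff`), the E-budget
  `∫⁻‖DV‖ₑ²‖y‖^{ρ−1} ≠ ⊤` and the A-growth `∫_{B_R}‖V‖² ≤ c·R^{1−2ρ}` (`R ≥ 1`) in REAL form (`NeedleThinCore.selfSimilar_needle_inputs`);
* `Loc.selfSimilar_ae_eq_zero_of_hasLqVorticityC2_profile_of_floor` — crux binders, `0 < ρ ≤ ½`, exact self-similarity, `V ∈ C²`,
  `MomentFloorLaw ρ V`, `HasLqVorticity ρ V` ⇒ `u = 0` a.e. (glue ⇒ `curl V ≡ 0` ⇒ `selfSimilar_ae_eq_zero_of_hasCompactSupport_curl`);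
* `Loc.selfSimilar_ae_eq_zero_of_subBorderlineC2_profile_of_floor` — the same for `HasSubBorderlineVorticity ρ V`.
[nsreg-p2 R53 §A/§B; cite: ChaeShvydkoy2013 §4 Thm 4.1 (the `L^q` exclusion, strain hypothesis replaced by the gauges + the floor)]

WHAT THIS IS NOT: not NS, not E — two CONDITIONAL members (strata of the MODEL-lattice crux class, modulo t57-F3); 19832 OPEN.
-/

noncomputable section

-- flat `Theorems/<Route><Decl>…` files of one crux share the namespace of the crux (tree convention)
set_option linter.dupNamespace false

open MeasureTheory Set Filter Topology Metric Function TopologicalSpace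
open scoped ENNReal NNReal ContDiff

namespace Summit.NavierStokesRegularity.NavierStokesRegularity.Theorems.PowerGaugeEulerLiouville

open Literature.Analysis Literature.Analysis.FunctionSpaces Literature.Analysis.FluidPDE

/-- **THE THREE R53 INPUTS OF A `C²` EXACTLY SELF-SIMILAR CLASS MEMBER** (`0 < ρ < 1`): a classical pressure `P'` making `(V,P')` a stationary
self-similar Euler profile at rate `1/(2+ρ)`, the weighted enstrophy `∫⁻‖DV‖ₑ²‖y‖^{ρ−1} < ∞` (E-gauge), and the energy growth
`∫_{B_R}‖V‖² ≤ c·R^{1−2ρ}` for `R ≥ 1` (A-gauge), in the REAL form the R53 faces are typed with. [folklore; ChaeShvydkoy2013 §1 (1.3)] -/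
theorem Floor.inputs_of_selfSimilarC2 {ρ : ℝ} (hρ : 0 < ρ) (hρ1 : ρ < 1)
    {u : ℝ → EuclideanSpace ℝ (Fin 3) → EuclideanSpace ℝ (Fin 3)} {p : ℝ → EuclideanSpace ℝ (Fin 3) → ℝ}
    {H : ℝ → EuclideanSpace ℝ (Fin 3) → EuclideanSpace ℝ (Fin 3) →L[ℝ] EuclideanSpace ℝ (Fin 3)} {c : ℝ≥0}
    (hsw : IsSuitableWeakSolutionOn (slab (EuclideanSpace ℝ (Fin 3)) (Iio 0) isOpen_Iio) 0 0 u p)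
    (hH : HasWeakSpatialGradientOn (slab (EuclideanSpace ℝ (Fin 3)) (Iio 0) isOpen_Iio) u H)
    (hgauge : ∀ a : ℝ, 0 < a →
      ENNReal.ofReal (a ^ (2 * ρ)) * cknA a (0 : ℝ × EuclideanSpace ℝ (Fin 3)) u +
          ENNReal.ofReal (a ^ ρ) * cknE a (0 : ℝ × EuclideanSpace ℝ (Fin 3)) H +
        ENNReal.ofReal (a ^ (2 * ρ)) * cknD a (0 : ℝ × EuclideanSpace ℝ (Fin 3)) p ≤ (c : ℝ≥0∞))
    {V : EuclideanSpace ℝ (Fin 3) → EuclideanSpace ℝ (Fin 3)} {P : EuclideanSpace ℝ (Fin 3) → ℝ}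
    (hu : ∀ τ : ℝ, τ < 0 → u τ = selfSimilarCollapse (1 / (2 + ρ)) 0 V τ)
    (hp : ∀ τ : ℝ, τ < 0 → p τ = selfSimilarCollapsePressure (1 / (2 + ρ)) 0 P τ)
    (hV : ContDiff ℝ 2 V) :
    ∃ P' : EuclideanSpace ℝ (Fin 3) → ℝ, IsSelfSimilarEulerProfile (1 / (2 + ρ)) 0 V P' ∧
      (∫⁻ y, ‖fderiv ℝ V y‖ₑ ^ 2 * ENNReal.ofReal (‖y‖ ^ (ρ - 1))) ≠ ⊤ ∧
      ∃ A : ℝ, ∀ R : ℝ, 1 ≤ R →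
        ∫ y in Metric.ball (0 : EuclideanSpace ℝ (Fin 3)) R, ‖V y‖ ^ 2 ≤ A * R ^ (1 - 2 * ρ) := by
  -- ### a classical pressure for the profile (as in `NeedleDigest.vorticity_support_upper_density`)
  have hD : ∀ a : ℝ, 0 < a → ENNReal.ofReal (a ^ (2 * ρ)) *
      cknD a (0 : ℝ × EuclideanSpace ℝ (Fin 3)) p ≤ (c : ℝ≥0∞) :=
    fun a ha => le_trans le_add_self (hgauge a ha)
  have hpm : AEStronglyMeasurable (uncurry p)
      (volume.restrict (Iio (0 : ℝ) ×ˢ (univ : Set (EuclideanSpace ℝ (Fin 3))))) := by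
    have := hsw.distributional.2.2.1.aestronglyMeasurable
    simpa [slab] using this
  have hPm := aestronglyMeasurable_pressureProfile hpm hp
  have hDprof := profile_pressure_weight_of_gaugeD hρ hρ1 hpm hp hD
  have hP1 : LocallyIntegrable P volume :=
    EnergySaturation.locallyIntegrable_pressure_of_weight hρ1 hPm
      (ENNReal.mul_ne_top ENNReal.ofReal_ne_top ENNReal.coe_ne_top) hDprof
  obtain ⟨P', hprof⟩ :=
    WeakToClassical.exists_isSelfSimilarEulerProfile_of_contDiff hsw.distributional hu hp hV hP1
  -- ### the two gauge inputs
  obtain ⟨hAl, hEl⟩ := NeedleThinCore.selfSimilar_needle_inputs hρ hρ1 hsw hH hgauge hu hp (hV.of_le one_le_two)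
  have hV2 : ∀ r : ℝ, MemLp V 2 (volume.restrict (ball (0 : EuclideanSpace ℝ (Fin 3)) r)) := fun r =>
    NeedleDigest.memLp_ball_of_continuous hV.continuous r 2
  refine ⟨P', hprof, ne_top_of_le_ne_top ENNReal.ofReal_ne_top hEl, (c : ℝ), fun R hR => ?_⟩
  have hint : IntegrableOn (fun y => ‖V y‖ ^ 2) (ball (0 : EuclideanSpace ℝ (Fin 3)) R) volume :=
    (hV2 R).integrable_norm_pow two_ne_zero
  have e : ∫ y in ball (0 : EuclideanSpace ℝ (Fin 3)) R, ‖V y‖ ^ 2 =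
      (∫⁻ y in ball (0 : EuclideanSpace ℝ (Fin 3)) R, ‖V y‖ₑ ^ 2).toReal := by
    rw [integral_eq_lintegral_of_nonneg_ae (Eventually.of_forall fun y => by positivity) hint.aestronglyMeasurable]
    congr 1
    refine lintegral_congr fun y => ?_
    rw [← ofReal_norm, ENNReal.ofReal_pow (norm_nonneg _)]
  rw [e, ← ENNReal.coe_toReal c, ← ENNReal.toReal_ofReal (by positivity : 0 ≤ R ^ (1 - 2 * ρ)), ← ENNReal.toReal_mul]
  exact ENNReal.toReal_mono (ENNReal.mul_ne_top ENNReal.coe_ne_top ENNReal.ofReal_ne_top) (hAl R (by linarith))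

/-- **FACE «L^q VORTICITY» AS A MEMBER, MODULO THE FLOOR.**  Crux binders verbatim, `0 < ρ ≤ ½`, exact self-similarity about the origin with
profile `(V,P)`, `V ∈ C²`; THE FLOOR `MomentFloor.MomentFloorLaw ρ V` (t57-F3); the face `MomentFloor.HasLqVorticity ρ V`
(`∫‖curl V‖^q < ∞` for one `q ∈ (0, 3/(2+ρ))`) ⇒ the member is trivial: the glue `curl_eq_zero_of_hasLqVorticity_of_momentFloorLaw` makes the
profile irrotational, and an irrotational profile of the class vanishes (`selfSimilar_ae_eq_zero_of_hasCompactSupport_curl`).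
[nsreg-p2 R53 (F5); cite: ChaeShvydkoy2013 §4 Thm 4.1] -/
theorem Loc.selfSimilar_ae_eq_zero_of_hasLqVorticityC2_profile_of_floor {ρ : ℝ} (hρ : 0 < ρ) (hρh : ρ ≤ 1 / 2)
    {u : ℝ → EuclideanSpace ℝ (Fin 3) → EuclideanSpace ℝ (Fin 3)} {p : ℝ → EuclideanSpace ℝ (Fin 3) → ℝ}
    {H : ℝ → EuclideanSpace ℝ (Fin 3) → EuclideanSpace ℝ (Fin 3) →L[ℝ] EuclideanSpace ℝ (Fin 3)} {c : ℝ≥0}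
    (hsw : IsSuitableWeakSolutionOn (slab (EuclideanSpace ℝ (Fin 3)) (Iio 0) isOpen_Iio) 0 0 u p)
    (hH : HasWeakSpatialGradientOn (slab (EuclideanSpace ℝ (Fin 3)) (Iio 0) isOpen_Iio) u H)
    (hgauge : ∀ a : ℝ, 0 < a →
      ENNReal.ofReal (a ^ (2 * ρ)) * cknA a (0 : ℝ × EuclideanSpace ℝ (Fin 3)) u +
          ENNReal.ofReal (a ^ ρ) * cknE a (0 : ℝ × EuclideanSpace ℝ (Fin 3)) H +
        ENNReal.ofReal (a ^ (2 * ρ)) * cknD a (0 : ℝ × EuclideanSpace ℝ (Fin 3)) p ≤ (c : ℝ≥0∞))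
    {V : EuclideanSpace ℝ (Fin 3) → EuclideanSpace ℝ (Fin 3)} {P : EuclideanSpace ℝ (Fin 3) → ℝ}
    (hu : ∀ τ : ℝ, τ < 0 → u τ = selfSimilarCollapse (1 / (2 + ρ)) 0 V τ)
    (hp : ∀ τ : ℝ, τ < 0 → p τ = selfSimilarCollapsePressure (1 / (2 + ρ)) 0 P τ)
    (hV : ContDiff ℝ 2 V)
    (hfloor : MomentFloor.MomentFloorLaw ρ V) (hface : MomentFloor.HasLqVorticity ρ V) :
    uncurry u =ᵐ[volume.restrict (Iio (0 : ℝ) ×ˢ (univ : Set (EuclideanSpace ℝ (Fin 3))))] 0 := by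
  obtain ⟨P', hprof, hE, hA⟩ := Floor.inputs_of_selfSimilarC2 hρ (by linarith) hsw hH hgauge hu hp hV
  have hcurl : ∀ y, curl V y = 0 :=
    MomentFloor.curl_eq_zero_of_hasLqVorticity_of_momentFloorLaw hρ.le hfloor hprof hE hA hface
  have hΩc : HasCompactSupport (curl V) := by
    rw [show curl V = 0 from funext hcurl]
    exact HasCompactSupport.zero
  exact selfSimilar_ae_eq_zero_of_hasCompactSupport_curl hρ u p H c V P' hsw hH hgauge hu hprof hΩc

/-- **FACE «SUB-BORDERLINE VORTICITY IN q-MEAN» AS A MEMBER, MODULO THE FLOOR.**  Crux binders verbatim, `0 < ρ ≤ ½`, exact self-similarity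
about the origin with profile `(V,P)`, `V ∈ C²`; THE FLOOR `MomentFloor.MomentFloorLaw ρ V` (t57-F3); the face
`MomentFloor.HasSubBorderlineVorticity ρ V` (for some `q ∈ (0,1)`: `∫_{B_R}‖curl V‖^q ≤ εR^{3−q(2+ρ)}` for every `ε > 0` along `R → ∞`) ⇒ the
member is trivial (glue `curl_eq_zero_of_subBorderline_of_momentFloorLaw` ⇒ irrotational ⇒ `selfSimilar_ae_eq_zero_of_hasCompactSupport_curl`).
[nsreg-p2 R53 §A; folklore] -/
theorem Loc.selfSimilar_ae_eq_zero_of_subBorderlineC2_profile_of_floor {ρ : ℝ} (hρ : 0 < ρ) (hρh : ρ ≤ 1 / 2)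
    {u : ℝ → EuclideanSpace ℝ (Fin 3) → EuclideanSpace ℝ (Fin 3)} {p : ℝ → EuclideanSpace ℝ (Fin 3) → ℝ}
    {H : ℝ → EuclideanSpace ℝ (Fin 3) → EuclideanSpace ℝ (Fin 3) →L[ℝ] EuclideanSpace ℝ (Fin 3)} {c : ℝ≥0}
    (hsw : IsSuitableWeakSolutionOn (slab (EuclideanSpace ℝ (Fin 3)) (Iio 0) isOpen_Iio) 0 0 u p)
    (hH : HasWeakSpatialGradientOn (slab (EuclideanSpace ℝ (Fin 3)) (Iio 0) isOpen_Iio) u H)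
    (hgauge : ∀ a : ℝ, 0 < a →
      ENNReal.ofReal (a ^ (2 * ρ)) * cknA a (0 : ℝ × EuclideanSpace ℝ (Fin 3)) u +
          ENNReal.ofReal (a ^ ρ) * cknE a (0 : ℝ × EuclideanSpace ℝ (Fin 3)) H +
        ENNReal.ofReal (a ^ (2 * ρ)) * cknD a (0 : ℝ × EuclideanSpace ℝ (Fin 3)) p ≤ (c : ℝ≥0∞))
    {V : EuclideanSpace ℝ (Fin 3) → EuclideanSpace ℝ (Fin 3)} {P : EuclideanSpace ℝ (Fin 3) → ℝ}
    (hu : ∀ τ : ℝ, τ < 0 → u τ = selfSimilarCollapse (1 / (2 + ρ)) 0 V τ)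
    (hp : ∀ τ : ℝ, τ < 0 → p τ = selfSimilarCollapsePressure (1 / (2 + ρ)) 0 P τ)
    (hV : ContDiff ℝ 2 V)
    (hfloor : MomentFloor.MomentFloorLaw ρ V) (hface : MomentFloor.HasSubBorderlineVorticity ρ V) :
    uncurry u =ᵐ[volume.restrict (Iio (0 : ℝ) ×ˢ (univ : Set (EuclideanSpace ℝ (Fin 3))))] 0 := by
  obtain ⟨P', hprof, hE, hA⟩ := Floor.inputs_of_selfSimilarC2 hρ (by linarith) hsw hH hgauge hu hp hV
  have hcurl : ∀ y, curl V y = 0 :=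
    MomentFloor.curl_eq_zero_of_subBorderline_of_momentFloorLaw hfloor hprof hE hA hface
  have hΩc : HasCompactSupport (curl V) := by
    rw [show curl V = 0 from funext hcurl]
    exact HasCompactSupport.zero
  exact selfSimilar_ae_eq_zero_of_hasCompactSupport_curl hρ u p H c V P' hsw hH hgauge hu hprof hΩc

end Summit.NavierStokesRegularity.NavierStokesRegularity.Theorems.PowerGaugeEulerLiouville
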